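import Literature.Topology.FourManifolds.GluckDissolveAssembly
import HarnessLib

/-!
# Gluck twists dissolve after one connected sum with `ℂℙ²`

For a 2-knot `K` and a tubular neighbourhood `ν`, the glued manifold `M = ν.Dissolve`
(`GluckDissolveGlued.lean`) is simultaneously

* a connected sum `Σ_K # ℂℙ²` for **every** Gluck twist `Σ_K` of `S⁴` along `K` presented
  through `ν` (`isConnectedSum_dissolve_of_isOpenGluing`): `M` is glued from the knot complement
  and the toric model `Ṽ ⊇ S² × ℝ² ∖ {p}` by Gluck's map `τ`, and
* a connected sum `S⁴ # ℂℙ²` (`isConnectedSum_sphere_dissolve`): through the monomial involution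
  `Ψ` of `Ṽ` the same `M` is glued *without* twist from the complement and `Ṽ`, along the
  reparametrised tubular neighbourhood `ν_λ (x, w) = ν (moebius (λ ‖w‖) x, w)` — the Möbius
  half-turn of the fibre sphere which `Ψ` produces (`Ψ_toModel`, `gluckMap_twistB`) is isotoped
  to a constant reparametrisation near the core by the cut-off `λ`.

Hence (`exists_isConnectedSum_complexProjectivePlane_of_isGluckTwist`) every Gluck twist `X`
admits a closed smooth `M` with `X # ℂℙ² ≅ M ≅ S⁴ # ℂℙ²` in the relational sense of the tree:
the classical dissolution `Σ_K # ℂℙ² ≅ S⁴ # ℂℙ²` (Gluck 1962 §17 for `S² ×~ S²`; Gompf–Stipsicz,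
*4-Manifolds and Kirby Calculus* (1999), Exercise 5.2.7(b) and its solution; Akbulut–Yasui,
*Gluck twisting 4-manifolds with odd intersection form* (2013), Cor. 1.3), here obtained by the
toric blow-up model rather than by Kirby calculus. This is the geometric input of the barrier
`Literature.Barriers.SmoothPoincare4.GluckTwistCP2Barrier`.
-/

noncomputable section

open scoped Manifold ContDiff Topology
open Set Function Metric Module Complex
open _root_.Topology

namespace Literature.Topology.FourManifolds

/-- Local notation: `𝔼 n` is the model Euclidean space `EuclideanSpace ℝ (Fin n)`. -/
local notation "𝔼 " n:arg => EuclideanSpace ℝ (Fin n)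

/-- Local notation: `𝕊 n` is the unit sphere in `EuclideanSpace ℝ (Fin (n + 1))`. -/
local notation "𝕊 " n:arg => (Metric.sphere (0 : EuclideanSpace ℝ (Fin (n + 1))) 1)

open ToricBlowup SphereCoord

namespace TwoKnot.TubularNbhd

variable {K : TwoKnot} (ν : TwoKnot.TubularNbhd K)

/-! ### Structure 1: `M = Σ_K # ℂℙ²` -/

/-- **The twisted side.** A Gluck twist `X` presented through `ν` gives dissolution data with
`μ = ν`, `T = τ` and `j = inr`. [folklore] -/
def twistedSide {X : Type} [TopologicalSpace X] [ChartedSpace (𝔼 4) X] (jA : K.complement → X)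
    (jB : (𝕊 2) × 𝔼 2 → X) (hA : Manifold.IsSmoothEmbedding (𝓡 4) (𝓡 4) ∞ jA) (hAo : IsOpen (range jA))
    (hB : Manifold.IsSmoothEmbedding ((𝓡 2).prod 𝓘(ℝ, 𝔼 2)) (𝓡 4) ∞ jB) (hBo : IsOpen (range jB))
    (hU : range jA ∪ range jB = univ) (hR : ∀ a b, jA a = jB b ↔ gluckRel ν a b) : DissolveSide ν X where
  jA := jA
  jB := jB
  μ := ν.toFun
  T := gluckMap
  j := ν.dissolveData.inr
  hjA := hA
  hjAo := hAo
  hjB := hB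
  hjBo := hBo
  hcov := hU
  hT := gluckMap_snd
  hTsurj b hb := ⟨gluckMapInv b, gluckMap_gluckMapInv hb⟩
  hrel := hR
  hμinj := ν.injective
  hμ0 x := ⟨x, (ν.apply_zero x).symm⟩
  hμK b hb := ν.apply_mem_compl_range b.1 hb
  hμA _ := Iff.rfl
  hj := ν.dissolveData.isSmoothEmbedding_inr
  hjo := ν.dissolveData.isOpen_range_inr
  hjcov := ν.dissolveData.range_inl_union_range_inr
  hjrel a v := ν.dissolve_inl_eq_inr_iff a v

/-- **`M` is a connected sum `X # ℂℙ²`** for every Gluck twist `X` of `S⁴` along `K` presented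
through the tubular neighbourhood `ν`. [folklore] -/
theorem isConnectedSum_dissolve_of_isOpenGluing {X : Type} [TopologicalSpace X] [T2Space X]
    [ChartedSpace (𝔼 4) X] [IsManifold (𝓡 4) ∞ X]
    (hX : IsOpenGluing (𝓡 4) ((𝓡 2).prod 𝓘(ℝ, 𝔼 2)) (𝓡 4) (A := K.complement) (B := (𝕊 2) × 𝔼 2)
      (P := X) (gluckRel ν)) :
    IsConnectedSum (𝓡 4) (𝓡 4) (𝓡 4) X ComplexProjectivePlane ν.Dissolve := by
  obtain ⟨jA, jB, hA, hAo, hB, hBo, hU, hR⟩ := hX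
  exact (ν.twistedSide jA jB hA hAo hB hBo hU hR).isConnectedSum

/-! ### Structure 2: `M = S⁴ # ℂℙ²` -/

/-! #### The cut-off `λ` and the reparametrisation `Λ` of `B` -/

/-- **The cut-off** `λ(r) = 1 + χ(2r - 1)(r - 1)` with `χ = Real.smoothTransition`: smooth,
positive, `λ = 1` on `r ≤ 1/2` and `λ(r) = r` on `r ≥ 1`. [folklore] -/
def lam (r : ℝ) : ℝ := 1 + Real.smoothTransition (2 * r - 1) * (r - 1)

/-- `λ = 1` for `r ≤ 1/2`. [folklore] -/
theorem lam_of_le {r : ℝ} (hr : r ≤ 1 / 2) : lam r = 1 := by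
  rw [lam, Real.smoothTransition.zero_of_nonpos (by linarith), zero_mul, add_zero]

/-- `λ(r) = r` for `r ≥ 1`. [folklore] -/
theorem lam_of_ge {r : ℝ} (hr : 1 ≤ r) : lam r = r := by
  rw [lam, Real.smoothTransition.one_of_one_le (by linarith), one_mul]; ring

/-- `λ > 0`. [folklore] -/
theorem lam_pos (r : ℝ) : 0 < lam r := by
  rw [lam]
  by_cases hr : r ≤ 1 / 2
  · rw [Real.smoothTransition.zero_of_nonpos (by linarith), zero_mul, add_zero]; exact one_pos
  · have h0 := Real.smoothTransition.nonneg (2 * r - 1)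
    have h1 := Real.smoothTransition.le_one (2 * r - 1)
    push Not at hr
    nlinarith

/-- `λ` is smooth. [folklore] -/
theorem contDiff_lam : ContDiff ℝ ∞ lam :=
  contDiff_const.add ((Real.smoothTransition.contDiff.comp
    ((contDiff_const.mul contDiff_id).sub contDiff_const)).mul (contDiff_id.sub contDiff_const))

/-- `w ↦ λ(‖w‖)` is smooth on the plane (it is constant near `0`). [folklore] -/
theorem contDiff_lam_norm : ContDiff ℝ ∞ fun w : 𝔼 2 => lam ‖w‖ := by
  rw [contDiff_iff_contDiffAt]
  intro w
  by_cases hw : ‖w‖ < 1 / 2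
  · have hev : (fun w : 𝔼 2 => lam ‖w‖) =ᶠ[𝓝 w] fun _ => 1 := by
      filter_upwards [(isOpen_lt continuous_norm continuous_const).mem_nhds hw] with w' hw'
      exact lam_of_le (le_of_lt hw')
    exact contDiffAt_const.congr_of_eventuallyEq hev
  · have hw0 : w ≠ 0 := by rintro rfl; simp at hw
    exact contDiff_lam.contDiffAt.comp w (contDiffAt_norm ℝ hw0)

/-- The complex scalar `λ(‖b.2‖)` is a smooth function on `B`. [folklore] -/
theorem contMDiff_lamC : ContMDiff ((𝓡 2).prod 𝓘(ℝ, 𝔼 2)) 𝓘(ℝ, ℂ) ∞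
    fun b : (𝕊 2) × 𝔼 2 => ((lam ‖b.2‖ : ℝ) : ℂ) :=
  ((Complex.ofRealCLM.contDiff.comp contDiff_lam_norm).contMDiff).comp contMDiff_snd

/-- **The reparametrisation** `Λ (x, w) = (moebius (λ ‖w‖) x, w)` of `B`, an involution. [folklore] -/
def Lam (b : (𝕊 2) × 𝔼 2) : (𝕊 2) × 𝔼 2 := (moebius ((lam ‖b.2‖ : ℝ) : ℂ) b.1, b.2)

/-- `Λ` preserves the fibre coordinate. [folklore] -/
@[simp] theorem Lam_snd (b : (𝕊 2) × 𝔼 2) : (Lam b).2 = b.2 := rfl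

/-- The scalar of `Λ` is nonzero. [folklore] -/
theorem lamC_ne_zero (w : 𝔼 2) : ((lam ‖w‖ : ℝ) : ℂ) ≠ 0 :=
  Complex.ofReal_ne_zero.2 (lam_pos _).ne'

/-- `Λ` is an involution. [folklore] -/
theorem Lam_Lam (b : (𝕊 2) × 𝔼 2) : Lam (Lam b) = b := by
  obtain ⟨x, w⟩ := b
  simp only [Lam]
  rw [moebius_moebius (lamC_ne_zero w)]

/-- `Λ` is smooth. [folklore] -/
theorem contMDiff_Lam : ContMDiff ((𝓡 2).prod 𝓘(ℝ, 𝔼 2)) ((𝓡 2).prod 𝓘(ℝ, 𝔼 2)) ∞ Lam :=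
  (contMDiff_moebius contMDiff_lamC (fun b => lamC_ne_zero b.2) contMDiff_fst).prodMk contMDiff_snd

/-- `Λ` as a homeomorphism. [folklore] -/
def LamHomeo : (𝕊 2) × 𝔼 2 ≃ₜ (𝕊 2) × 𝔼 2 where
  toFun := Lam
  invFun := Lam
  left_inv := Lam_Lam
  right_inv := Lam_Lam
  continuous_toFun := contMDiff_Lam.continuous
  continuous_invFun := contMDiff_Lam.continuous

/-- `Λ` on the end is the Möbius map of parameter `‖w‖`. [folklore] -/
theorem Lam_of_one_le {b : (𝕊 2) × 𝔼 2} (hb : 1 ≤ ‖b.2‖) : Lam b = (moebius (‖b.2‖ : ℂ) b.1, b.2) := by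
  rw [Lam, lam_of_ge hb]

/-- `Λ` preserves `S² × B̄(0, 1)`. [folklore] -/
theorem image_Lam_closedBall : Lam '' (univ ×ˢ closedBall (0 : 𝔼 2) 1) = univ ×ˢ closedBall (0 : 𝔼 2) 1 := by
  have hsub : ∀ b : (𝕊 2) × 𝔼 2, b ∈ univ ×ˢ closedBall (0 : 𝔼 2) 1 → Lam b ∈ univ ×ˢ closedBall (0 : 𝔼 2) 1 :=
    fun b hb => ⟨mem_univ _, hb.2⟩
  refine Subset.antisymm (by rintro _ ⟨b, hb, rfl⟩; exact hsub b hb) fun b hb => ⟨Lam b, hsub b hb, Lam_Lam b⟩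

/-! #### The reparametrised tubular neighbourhood `ν_λ = ν ∘ Λ` -/

/-- **The reparametrised tube** `ν_λ (x, w) = ν (moebius (λ ‖w‖) x, w)`. [folklore] -/
def nuLam (b : (𝕊 2) × 𝔼 2) : 𝕊 4 := ν.toFun (Lam b)

/-- `ν_λ` is a smooth embedding. [folklore] -/
theorem isSmoothEmbedding_nuLam : Manifold.IsSmoothEmbedding ((𝓡 2).prod 𝓘(ℝ, 𝔼 2)) (𝓡 4) ∞ ν.nuLam :=
  ν.isSmoothEmbedding.comp_openPartialHomeomorph LamHomeo.toOpenPartialHomeomorph rfl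
    contMDiff_Lam.contMDiffOn contMDiff_Lam.contMDiffOn

/-- The range of `ν_λ` is the range of `ν`. [folklore] -/
theorem range_nuLam : range ν.nuLam = range ν.toFun :=
  Subset.antisymm (range_comp_subset_range _ _) fun _ ⟨b, hb⟩ => ⟨Lam b, by rw [nuLam, Lam_Lam]; exact hb⟩

/-- `ν_λ` is injective. [folklore] -/
theorem nuLam_injective : Injective ν.nuLam := fun a b h => by
  have := ν.injective h
  rw [← Lam_Lam a, this, Lam_Lam]

/-- On the zero section `ν_λ` lies on the knot. [folklore] -/
theorem nuLam_zero_mem (x : 𝕊 2) : ν.nuLam (x, 0) ∈ range K :=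
  ⟨moebius ((lam ‖(0 : 𝔼 2)‖ : ℝ) : ℂ) x, (ν.apply_zero _).symm⟩

/-- Off the zero section `ν_λ` misses the knot. [folklore] -/
theorem nuLam_not_mem {b : (𝕊 2) × 𝔼 2} (hb : b.2 ≠ 0) : ν.nuLam b ∉ range K :=
  ν.apply_mem_compl_range _ hb

/-- `ν_λ (S² × B̄(0,1)) = ν (S² × B̄(0,1))`. [folklore] -/
theorem image_nuLam_closedBall :
    ν.nuLam '' (univ ×ˢ closedBall (0 : 𝔼 2) 1) = ν.toFun '' (univ ×ˢ closedBall (0 : 𝔼 2) 1) := by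
  rw [show ν.nuLam = ν.toFun ∘ Lam from rfl, image_comp, image_Lam_closedBall]

/-- **The untwisted side.** `S⁴` is glued from the knot complement (by the inclusion) and `B` (by
`ν_λ`) without twist, and `M` receives `Ṽ` through `inr ∘ Ψ`. [folklore] -/
def untwistedSide : DissolveSide ν (𝕊 4) where
  jA := Subtype.val
  jB := ν.nuLam
  μ := ν.nuLam
  T := id
  j := ν.dissolveData.inr ∘ Ψ
  hjA := Manifold.IsSmoothEmbedding.of_opens K.complement
  hjAo := by rw [Subtype.range_coe]; exact K.complement.isOpen
  hjB := ν.isSmoothEmbedding_nuLam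
  hjBo := by rw [range_nuLam]; exact ν.isOpenEmbedding.isOpen_range
  hcov := by
    rw [Subtype.range_coe, range_nuLam]
    refine eq_univ_of_forall fun x => ?_
    by_cases hx : x ∈ range K
    · exact Or.inr (ν.range_subset_range hx)
    · exact Or.inl hx
  hT _ := rfl
  hTsurj b _ := ⟨b, rfl⟩
  hrel a b := by
    constructor
    · intro h
      refine ⟨fun hb0 => ?_, h⟩
      have ha := (SphereEmbedding.mem_complement_iff K (a : 𝕊 4)).1 a.2
      apply ha
      rw [h]
      obtain ⟨x, w⟩ := b
      change w = 0 at hb0; subst hb0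
      exact ν.nuLam_zero_mem x
    · exact fun h => h.2
  hμinj := ν.nuLam_injective
  hμ0 := ν.nuLam_zero_mem
  hμK _ hb := ν.nuLam_not_mem hb
  hμA a := by rw [mem_dissolveA_iff, image_nuLam_closedBall]
  hj := ν.dissolveData.isSmoothEmbedding_inr_comp (by
    simpa using isSmoothEmbedding_diffeomorph_of_boundaryless ΨDiffeo (ContinuousLinearEquiv.refl ℝ _))
  hjo := by rw [range_comp, involutive_Ψ.surjective.range_eq, image_univ]; exact ν.dissolveData.isOpen_range_inr
  hjcov := by
    rw [range_comp, involutive_Ψ.surjective.range_eq, image_univ]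
    exact ν.dissolveData.range_inl_union_range_inr
  hjrel a v := by
    change ν.dissolveData.inl a = ν.dissolveData.inr (Ψ v) ↔ _
    rw [ν.dissolve_inl_eq_inr_iff]
    constructor
    · rintro ⟨b', hb', hv, hab⟩
      have hw : b'.2 ≠ 0 := snd_ne_zero_of_mem_endB hb'
      refine ⟨twistB b', hb', ?_, ?_⟩
      · rw [← Ψ_toModel hw, ← hv, Ψ_Ψ]
      · rw [hab, ← twistB_twistB hw, gluckMap_twistB (by rw [twistB_snd]; exact hw), twistB_twistB hw]
        change _ = ν.toFun (Lam (twistB b'))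
        rw [Lam_of_one_le (by rw [twistB_snd]; exact le_of_lt hb')]
    · rintro ⟨b, hb, rfl, hab⟩
      have hw : b.2 ≠ 0 := snd_ne_zero_of_mem_endB hb
      refine ⟨twistB b, hb, (Ψ_toModel hw), ?_⟩
      rw [hab, gluckMap_twistB hw]
      change ν.toFun (Lam b) = _
      rw [Lam_of_one_le (le_of_lt hb)]

/-- **`M` is a connected sum `S⁴ # ℂℙ²`.** [folklore] -/
theorem isConnectedSum_sphere_dissolve :
    IsConnectedSum (𝓡 4) (𝓡 4) (𝓡 4) (𝕊 4) ComplexProjectivePlane ν.Dissolve :=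
  ν.untwistedSide.isConnectedSum

end TwoKnot.TubularNbhd

/-! ### Gluck twists dissolve -/

/-- **Gluck twists dissolve after one `ℂℙ²` summand (relational form).** For every 2-knot `K` and
every closed smooth 4-manifold `X` which is a Gluck twist of `S⁴` along `K` there is a closed
smooth 4-manifold `M` which is at the same time a connected sum `X # ℂℙ²` and a connected sum
`S⁴ # ℂℙ²` (in the sense of `Literature.Topology.FourManifolds.IsConnectedSum`); `M` is the
manifold `(S⁴ ∖ ν(S² × D²)) ∪_τ Bl_p(S² × ℝ²)`. Gompf–Stipsicz (1999), Exercise 5.2.7(b);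
Akbulut–Yasui (2013), Cor. 1.3; Gluck (1962), §17. [cite: GompfStipsicz1999, Exercise 5.2.7(b)] -/
theorem exists_isConnectedSum_complexProjectivePlane_of_isGluckTwist (K : TwoKnot) (X : Type)
    [TopologicalSpace X] [T2Space X] [ChartedSpace (𝔼 4) X] [IsManifold (𝓡 4) ∞ X]
    (hX : IsGluckTwist (𝓡 4) X K) :
    ∃ (M : Type) (_ : TopologicalSpace M) (_ : T2Space M) (_ : SecondCountableTopology M)
      (_ : ChartedSpace (𝔼 4) M) (_ : IsManifold (𝓡 4) ∞ M) (_ : CompactSpace M),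
      IsConnectedSum (𝓡 4) (𝓡 4) (𝓡 4) X ComplexProjectivePlane M ∧
        IsConnectedSum (𝓡 4) (𝓡 4) (𝓡 4) (𝕊 4) ComplexProjectivePlane M := by
  obtain ⟨ν, hν⟩ := hX
  exact ⟨ν.Dissolve, inferInstance, inferInstance, inferInstance, inferInstance, inferInstance, inferInstance,
    ν.isConnectedSum_dissolve_of_isOpenGluing hν, ν.isConnectedSum_sphere_dissolve⟩

end Literature.Topology.FourManifolds
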